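import Summits.RiemannHypothesis.RiemannHypothesis.Theorems.Splittings.LiCurvatureSignChangesRH
import Summits.RiemannHypothesis.RiemannHypothesis.Theorems.Splittings.LiSecondOrderCriterion
import Summits.RiemannHypothesis.RiemannHypothesis.Theorems.Splittings.LiExtremalLayer
import HarnessLib

/-!
# The TURÁN (LOG-CONCAVITY) LAW for the Keiper–Li coefficients, RH branch (SketchG10 §§1–3)

Cell rh-split, seat rh-split-li-bridge g10 (brief sha16 f79c5f09d8bcb036), card `run/shared/lean/pub/rh-split/cards/SPLIT-li-bridge.md` §17;
kernel source `HOME/rh-split-li-bridge/SketchG10.lean` sha16 38c6e923d0f0bc96 (759 l, farm rc 0 · 0 err · 0 warn, std axioms), cut by the seat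
at the scratch's section boundaries (§§1–3 / §4 / §§5–6), decl text byte-verbatim; deltas = namespace `RhSplit.LiBridgeG10` ↦
`…Theorems.Splittings.LiTuranLaw`, imports, module docstrings.
Tree inputs only (cited, not re-derived): `Voros2006_thm_onlyif_holds` (`λ_n = ½n(log n − 1 + γ − log 2π) + o(n)` under RH),
`LiCurvatureSignChanges.liSecondDiff_two_signs_of_rh` (file `LiCurvatureSignChangesRH`: under RH the second difference
`d_n = λ_{n+2} − 2λ_{n+1} + λ_n` is `≥ η` and `≤ −η` in every window of a fixed length), `LiSecondOrderCriterion.abs_liSecondDiff_le_of_rh` /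
`abs_liIncr_sub_liIncr_le_of_rh` (Xiao: `|d_n| ≤ 2λ₁`, so the increments `Δ_n = λ_{n+1} − λ_n` are `2λ₁`-Lipschitz), Mathlib's
`isLittleO_log_rpow_atTop` (`log x = o(√x)`).  Standard axioms.  Zero definitions.

THE LAW.  Write `λ_n = keiperLiCoeff n` and `T_{n+1} := λ_{n+1}² − λ_n λ_{n+2}` (the Turán / Toeplitz `2×2` determinant of the Li
sequence at index `n+1`; `T_{n+1} ≥ 0 ∀ n ≥ N` says `(λ_n)` is eventually LOG-CONCAVE, `T_{n+1} ≤ 0 ∀ n ≥ N` eventually log-convex).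
The identity `T_{n+1} = −λ_{n+1}·d_n + Δ_n·Δ_{n+1}` couples `T` to the curvature `d_n`.

* RH ⟹ `T_{n+1} > 0` on a SYNDETIC set (`turanHold_syndetic_of_rh`, `turanHold_io_of_rh`, §2): at the window points with `d_n ≤ −η`,
  `T_{n+1} ≥ η(n+1)/2 − d_n²/4 ≥ η(n+1)/2 − λ₁² > 0` (uses `λ_n ≥ n/2` eventually, `li_linear_bounds_of_rh`, §1).
* RH ⟹ `T_{n+1} < 0` for INFINITELY MANY `n` (`turanFail_io_of_rh`, §3): the Li sequence is NOT eventually log-concave under RH.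
  Proof: if `T ≥ 0` from `N` on, then at the window points with `d_n ≥ η` one gets `Δ_nΔ_{n+1} ≥ ηλ_{n+1} ≥ η(n+1)/2`, hence
  `|Δ_n| ≥ √(ηn/2) − λ₁`; Lipschitz propagation over the bounded gaps makes `|Δ_m| ≥ √(ηm/2) − K` for ALL large `m`, the sign of
  `Δ_m` freezes (positive, else `λ → −∞`), so `λ_{2n} − λ_n ≥ n(√(ηn/2) − K)`, i.e. `λ_{2n} ≫ n^{3/2}`, contradicting
  `λ_{2n} ≤ n(log 2n + 1)` (Voros) and `log = o(√·)`.
* Hence `turan_two_signs_of_rh` (under RH the Turán determinant takes both strict signs beyond every index) and the two REFUTATION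
  CRITERIA `not_rh_of_eventually_logConcave`, `not_rh_of_eventually_logConvex`: eventual log-concavity of `(λ_n)`, or eventual
  log-convexity, each REFUTES RH — neither needs a negative `λ_n`.
The `¬RH` branch (window mean over the extremal layer: `T > 0` on a syndetic set WITHOUT RH, hence unconditionally; `¬RH` with a
one-pair extremal layer ⟹ eventually log-concave) is in `LiTuranTrigWindow` / `LiTuranLaw`.

Numerics (card §17.2; table `rh-splitx/data/li-keiper/li_lambda_N100000.tsv`, 40 digits, signs certified against table rounding):
`T_n > 0` for `2 ≤ n ≤ 252`, first failure `n = 253`, failure density `0.280 / 0.462 / 0.495` on `[10², 10³) / [10³, 10⁴) / [10⁴, 10⁵)`,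
`sign T_n = −sign d_{n−1}` for `98.9 %` of `n ≤ 10⁵`.  In print: NULL — no log-concavity / Turán-inequality statement for the Li–Keiper
coefficients was found in corpus (fts + vec) or galaxy (card §17.3 lists the queries).

HONEST LABEL: «SPLITTING SEARCH over kernel-typed RH-EQUIVALENCES; a splitting A ∧ B ⟹ RH is CONDITIONAL bookkeeping unless A and B are
both proved; nothing here bears on the truth of RH.»  Every theorem below is an RH-CONSEQUENCE (`RiemannHypothesis → …`) or its contrapositive (`… → ¬RiemannHypothesis`);
none is an RH-equivalence and none is claimed to be; certifies nothing about RH.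
-/

set_option linter.dupNamespace false

noncomputable section

open Filter Topology Asymptotics
open scoped ComplexConjugate

namespace Summit.RiemannHypothesis.RiemannHypothesis.Theorems.Splittings.LiTuranLaw

open Literature.NumberTheory.LFunctions
open Summit.RiemannHypothesis.RiemannHypothesis.Theorems.Splittings
open Summit.RiemannHypothesis.RiemannHypothesis.Theorems.Splittings.LiCurvatureSignChanges
open Summit.RiemannHypothesis.RiemannHypothesis.Theorems.Splittings.LiSecondOrderCriterion
open Summit.RiemannHypothesis.RiemannHypothesis.Theorems.Splittings.LiExtremalLayer

/-! ## §1 Inputs in the shape used below -/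

/-- Under RH, beyond a threshold `n/2 ≤ λ_n ≤ (n/2)(log n + 1)` (the tree's `Voros2006_thm_onlyif_holds` at `ε = ½`, exactly as in
`LiExtremalLayer.eventually_pos_of_rh`; the upper bound uses `γ < 2/3` and `log 2π ≥ 0`). -/
theorem li_linear_bounds_of_rh (hRH : _root_.RiemannHypothesis) :
    ∃ N₁ : ℕ, ∀ n : ℕ, N₁ ≤ n →
      (n : ℝ) / 2 ≤ keiperLiCoeff n ∧ keiperLiCoeff n ≤ (n : ℝ) / 2 * (Real.log n + 1) := by
  have hV := (Voros2006_thm_onlyif_holds hRH).def (show (0 : ℝ) < 1 / 2 by norm_num)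
  obtain ⟨N, hN⟩ := eventually_atTop.1 (hV.and (eventually_ge_atTop (2 ^ 14)))
  refine ⟨N, fun n hn ↦ ?_⟩
  obtain ⟨hb, hn14⟩ := hN n hn
  have hn14' : (2 : ℝ) ^ 14 ≤ n := by exact_mod_cast hn14
  have hlog2 : (0.6931471803 : ℝ) < Real.log 2 := Real.log_two_gt_d9
  have hlogn : Real.log ((2 : ℝ) ^ 14) ≤ Real.log n := Real.log_le_log (by positivity) hn14'
  rw [Real.log_pow] at hlogn
  push_cast at hlogn
  have hγ : (1 : ℝ) / 2 < Real.eulerMascheroniConstant := Real.one_half_lt_eulerMascheroniConstant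
  have hγ' : Real.eulerMascheroniConstant < 2 / 3 := Real.eulerMascheroniConstant_lt_two_thirds
  have hlog2π : Real.log (2 * Real.pi) ≤ 2 * Real.pi - 1 := Real.log_le_sub_one_of_pos (by positivity)
  have hlog2π' : 0 ≤ Real.log (2 * Real.pi) := Real.log_nonneg (by linarith [Real.pi_gt_three])
  have hπ : Real.pi ≤ 4 := Real.pi_le_four
  have hbr : 2 ≤ Real.log n - 1 + Real.eulerMascheroniConstant - Real.log (2 * Real.pi) := by linarith
  have hbr' : Real.log n - 1 + Real.eulerMascheroniConstant - Real.log (2 * Real.pi) ≤ Real.log n := by linarith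
  rw [Real.norm_eq_abs, Real.norm_eq_abs, Nat.abs_cast] at hb
  obtain ⟨h1, h2⟩ := abs_le.1 hb
  have hn0 : (0 : ℝ) ≤ n := Nat.cast_nonneg n
  constructor
  · nlinarith
  · nlinarith

/-- The Turán identity: `b² − ac = −b·(c − 2b + a) + (b − a)(c − b)`, i.e. `T_{n+1} = −λ_{n+1} d_n + Δ_n Δ_{n+1}`. -/
private theorem turan_identity (a b c : ℝ) : b ^ 2 - a * c = -(b * (c - 2 * b + a)) + (b - a) * (c - b) := by
  ring

/-! ## §2 RH ⟹ the Turán determinant is POSITIVE on a syndetic set (`λ_n λ_{n+2} < λ_{n+1}²` with bounded gaps) -/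

/-- **RH ⟹ `T_{n+1} > 0` syndetically.**  At the window points with `d_n ≤ −η`:
`T_{n+1} = −λ_{n+1} d_n + Δ_n(Δ_n + d_n) ≥ ηλ_{n+1} − d_n²/4 ≥ η(n+1)/2 − λ₁² > 0`. RH-CONSEQUENCE. -/
theorem turanHold_syndetic_of_rh (hRH : _root_.RiemannHypothesis) :
    ∃ L n₀ : ℕ, ∀ N : ℕ, n₀ ≤ N →
      ∃ n ∈ Finset.Ico N (N + L), keiperLiCoeff n * keiperLiCoeff (n + 2) < keiperLiCoeff (n + 1) ^ 2 := by
  obtain ⟨η, hη, L, hwin⟩ := liSecondDiff_two_signs_of_rh hRH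
  obtain ⟨N₁, hN₁⟩ := li_linear_bounds_of_rh hRH
  set ℓ : ℝ := 2 * keiperLiCoeff 1 with hℓ
  refine ⟨L, N₁ + ⌈ℓ ^ 2 / (2 * η)⌉₊ + 1, fun N hN ↦ ?_⟩
  obtain ⟨-, ⟨n, hnI, hdn⟩⟩ := hwin N (by omega)
  have hnI' := Finset.mem_Ico.1 hnI
  refine ⟨n, hnI, ?_⟩
  have hlow := (hN₁ (n + 1) (by omega)).1
  push_cast at hlow
  have hd := abs_liSecondDiff_le_of_rh hRH (n := n) (by omega)
  have hceil : ℓ ^ 2 / (2 * η) ≤ (n : ℝ) := by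
    have h1 : (⌈ℓ ^ 2 / (2 * η)⌉₊ : ℝ) ≤ n := by exact_mod_cast (by omega : ⌈ℓ ^ 2 / (2 * η)⌉₊ ≤ n)
    exact (Nat.le_ceil _).trans h1
  rw [div_le_iff₀ (by positivity)] at hceil
  have hid := turan_identity (keiperLiCoeff n) (keiperLiCoeff (n + 1)) (keiperLiCoeff (n + 2))
  -- `−λ_{n+1} d_n ≥ η (n+1)/2`
  have hmain : η * (((n : ℝ) + 1) / 2) ≤
      -(keiperLiCoeff (n + 1) * (keiperLiCoeff (n + 2) - 2 * keiperLiCoeff (n + 1) + keiperLiCoeff n)) := by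
    have := mul_le_mul (show η ≤ -(keiperLiCoeff (n + 2) - 2 * keiperLiCoeff (n + 1) + keiperLiCoeff n) by linarith)
      hlow (by positivity) (by linarith)
    linarith
  -- `Δ_n Δ_{n+1} = Δ_n (Δ_n + d_n) ≥ −d_n²/4 ≥ −ℓ²/4`
  have hsq : (keiperLiCoeff (n + 2) - 2 * keiperLiCoeff (n + 1) + keiperLiCoeff n) ^ 2 ≤ ℓ ^ 2 := by
    rw [← sq_abs]
    exact pow_le_pow_left₀ (abs_nonneg _) hd 2
  nlinarith [sq_nonneg (keiperLiCoeff (n + 1) - keiperLiCoeff n +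
    (keiperLiCoeff (n + 2) - 2 * keiperLiCoeff (n + 1) + keiperLiCoeff n) / 2)]

/-- **RH ⟹ `λ_n λ_{n+2} < λ_{n+1}²` for infinitely many `n`.** RH-CONSEQUENCE. -/
theorem turanHold_io_of_rh (hRH : _root_.RiemannHypothesis) (N : ℕ) :
    ∃ n : ℕ, N ≤ n ∧ keiperLiCoeff n * keiperLiCoeff (n + 2) < keiperLiCoeff (n + 1) ^ 2 := by
  obtain ⟨L, n₀, h⟩ := turanHold_syndetic_of_rh hRH
  obtain ⟨n, hn, hlt⟩ := h (max N n₀) (le_max_right _ _)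
  exact ⟨n, (le_max_left _ _).trans (Finset.mem_Ico.1 hn).1, hlt⟩

/-! ## §3 RH ⟹ the Turán determinant is NEGATIVE infinitely often: the Li sequence is not eventually log-concave -/

/-- **RH ⟹ `λ_{n+1}² < λ_n λ_{n+2}` for infinitely many `n`** (the Turán / log-concavity inequality FAILS infinitely often).
RH-CONSEQUENCE; the proof is the window/Lipschitz/growth argument of the file header. -/
theorem turanFail_io_of_rh (hRH : _root_.RiemannHypothesis) (N : ℕ) :
    ∃ n : ℕ, N ≤ n ∧ keiperLiCoeff (n + 1) ^ 2 < keiperLiCoeff n * keiperLiCoeff (n + 2) := by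
  by_contra hcon
  push Not at hcon
  -- `hcon : ∀ n, N ≤ n → λ_n λ_{n+2} ≤ λ_{n+1}²` (eventual log-concavity)
  obtain ⟨η, hη, L, hwin⟩ := liSecondDiff_two_signs_of_rh hRH
  obtain ⟨N₁, hN₁⟩ := li_linear_bounds_of_rh hRH
  -- opaque abbreviations for the increments and for `S m = √(η m / 2)`
  obtain ⟨Δ, hΔ⟩ : ∃ Δ : ℕ → ℝ, ∀ n, Δ n = keiperLiCoeff (n + 1) - keiperLiCoeff n := ⟨_, fun _ ↦ rfl⟩
  obtain ⟨S, hS⟩ : ∃ S : ℕ → ℝ, ∀ m, S m = Real.sqrt (η * m / 2) := ⟨_, fun _ ↦ rfl⟩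
  have hSmono : ∀ m n : ℕ, m ≤ n → S m ≤ S n := fun m n hmn ↦ by
    rw [hS, hS]
    exact Real.sqrt_le_sqrt (by
      have : (m : ℝ) ≤ n := by exact_mod_cast hmn
      nlinarith)
  have hSnn : ∀ m, 0 ≤ S m := fun m ↦ by rw [hS]; exact Real.sqrt_nonneg _
  set ℓ : ℝ := 2 * keiperLiCoeff 1 with hℓ
  have hℓ0 : 0 ≤ ℓ := (abs_nonneg _).trans (abs_liSecondDiff_le_of_rh hRH (n := 1) le_rfl)
  have hdℓ : ∀ n : ℕ, 1 ≤ n → |keiperLiCoeff (n + 2) - 2 * keiperLiCoeff (n + 1) + keiperLiCoeff n| ≤ ℓ :=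
    fun n hn ↦ abs_liSecondDiff_le_of_rh hRH hn
  set K : ℝ := ℓ / 2 + L * ℓ with hK
  have hK0 : 0 ≤ K := by positivity
  set M₀ : ℕ := N + N₁ + 1 with hM₀
  -- Step 1–2: `|Δ_m| ≥ S m − K` for every `m ≥ M₀`
  have R : ∀ m : ℕ, M₀ ≤ m → S m - K ≤ |Δ m| := by
    intro m hm
    obtain ⟨⟨n, hnI, hdn⟩, -⟩ := hwin m (by omega)
    obtain ⟨hmn, hnL⟩ := Finset.mem_Ico.1 hnI
    have hH := hcon n (by omega)
    have hlow := (hN₁ (n + 1) (by omega)).1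
    push_cast at hlow
    have hd := hdℓ n (by omega)
    have hid := turan_identity (keiperLiCoeff n) (keiperLiCoeff (n + 1)) (keiperLiCoeff (n + 2))
    -- `Δ_n Δ_{n+1} ≥ λ_{n+1} d_n ≥ η (n+1)/2`
    have hprod : η * (((n : ℝ) + 1) / 2) ≤
        (keiperLiCoeff (n + 1) - keiperLiCoeff n) * (keiperLiCoeff (n + 2) - keiperLiCoeff (n + 1)) := by
      have := mul_le_mul hdn hlow (by positivity) (by linarith)
      linarith
    -- with `x = |Δ_n|`: `Δ_n Δ_{n+1} = Δ_n² + Δ_n d_n ≤ x² + x ℓ`, so `(x + ℓ/2)² ≥ η m / 2`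
    have hx2 : (keiperLiCoeff (n + 1) - keiperLiCoeff n) ^ 2 = |Δ n| ^ 2 := by rw [hΔ, sq_abs]
    have hxd : (keiperLiCoeff (n + 1) - keiperLiCoeff n) *
        (keiperLiCoeff (n + 2) - 2 * keiperLiCoeff (n + 1) + keiperLiCoeff n) ≤ |Δ n| * ℓ := by
      refine (le_abs_self _).trans ?_
      rw [abs_mul, hΔ]
      exact mul_le_mul_of_nonneg_left hd (abs_nonneg _)
    have hmn' : (m : ℝ) ≤ n := by exact_mod_cast hmn
    have hsq : η * m / 2 ≤ (|Δ n| + ℓ / 2) ^ 2 := by nlinarith [abs_nonneg (Δ n)]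
    have hSn : S m ≤ |Δ n| + ℓ / 2 := by
      rw [hS]
      calc Real.sqrt (η * m / 2) ≤ Real.sqrt ((|Δ n| + ℓ / 2) ^ 2) := Real.sqrt_le_sqrt hsq
        _ = |Δ n| + ℓ / 2 := Real.sqrt_sq (by positivity)
    -- Lipschitz from `m` to `n`
    have hlip := abs_liIncr_sub_liIncr_le_of_rh hRH (n := m) (m := n) (by omega) hmn
    rw [← hΔ, ← hΔ] at hlip
    have hnL' : (n : ℝ) - m ≤ L := by
      have : (n : ℝ) < (m : ℝ) + L := by exact_mod_cast hnL
      linarith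
    have hlip' : |Δ n - Δ m| ≤ L * ℓ := by
      refine hlip.trans ?_
      rw [hℓ]
      have := mul_le_mul_of_nonneg_left hnL' hℓ0
      linarith
    have htri := abs_sub_abs_le_abs_sub (Δ n) (Δ m)
    rw [hK]
    linarith
  -- threshold `M₁`: `S m ≥ K + 2ℓ + 1` for `m ≥ M₁`
  set M₁ : ℕ := M₀ + ⌈2 * (K + 2 * ℓ + 1) ^ 2 / η⌉₊ with hM₁
  have hSM₁ : ∀ m : ℕ, M₁ ≤ m → K + 2 * ℓ + 1 ≤ S m := by
    intro m hm
    have h1 : 2 * (K + 2 * ℓ + 1) ^ 2 / η ≤ (m : ℝ) := by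
      have : (⌈2 * (K + 2 * ℓ + 1) ^ 2 / η⌉₊ : ℝ) ≤ m := by
        exact_mod_cast (by omega : ⌈2 * (K + 2 * ℓ + 1) ^ 2 / η⌉₊ ≤ m)
      exact (Nat.le_ceil _).trans this
    rw [div_le_iff₀ hη] at h1
    rw [hS]
    calc K + 2 * ℓ + 1 = Real.sqrt ((K + 2 * ℓ + 1) ^ 2) := (Real.sqrt_sq (by positivity)).symm
      _ ≤ Real.sqrt (η * m / 2) := Real.sqrt_le_sqrt (by nlinarith)
  -- Step 3: the sign of `Δ_m` freezes positive for `m ≥ M₁`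
  have P : ∀ m : ℕ, M₁ ≤ m → 0 < Δ m := by
    intro m hm
    by_contra hneg
    push Not at hneg
    have I : ∀ j : ℕ, Δ (m + j) ≤ -1 ∧ keiperLiCoeff (m + j) ≤ keiperLiCoeff m - j := by
      intro j
      induction j with
      | zero =>
        have hR := R m (by omega)
        have hSj := hSM₁ m hm
        have habs : |Δ m| = -Δ m := abs_of_nonpos hneg
        refine ⟨by rw [Nat.add_zero]; linarith, by simp⟩
      | succ j ih =>
        obtain ⟨ih1, ih2⟩ := ih
        have hR := R (m + j) (by omega)
        have hSj := hSM₁ (m + j) (by omega)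
        have habs : |Δ (m + j)| = -Δ (m + j) := abs_of_nonpos (by linarith)
        have hd := hdℓ (m + j) (by omega)
        have hd2 := (abs_le.1 hd).2
        have e1 : Δ (m + (j + 1)) = Δ (m + j) +
            (keiperLiCoeff (m + j + 2) - 2 * keiperLiCoeff (m + j + 1) + keiperLiCoeff (m + j)) := by
          rw [hΔ, hΔ, show m + (j + 1) + 1 = m + j + 2 by ring, show m + (j + 1) = m + j + 1 by ring]
          ring
        have e2 : keiperLiCoeff (m + (j + 1)) = keiperLiCoeff (m + j) + Δ (m + j) := by
          rw [hΔ, show m + (j + 1) = m + j + 1 by ring]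
          ring
        refine ⟨by rw [e1]; linarith, ?_⟩
        rw [e2]
        push_cast
        linarith
    set j : ℕ := ⌈keiperLiCoeff m⌉₊ + 1 with hj
    have hj' : keiperLiCoeff m + 1 ≤ (j : ℝ) := by
      rw [hj]
      push_cast
      linarith [Nat.le_ceil (keiperLiCoeff m)]
    have hlowj := (hN₁ (m + j) (by omega)).1
    have hpos : (0 : ℝ) ≤ ((m + j : ℕ) : ℝ) / 2 := by positivity
    linarith [(I j).2]
  have P' : ∀ m : ℕ, M₁ ≤ m → S m - K ≤ Δ m := fun m hm ↦ by
    have := R m (by omega)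
    rwa [abs_of_pos (P m hm)] at this
  -- Step 4: summation `λ_{n+k} − λ_n ≥ k (S n − K)` for `n ≥ M₁`
  have Q : ∀ n : ℕ, M₁ ≤ n → ∀ k : ℕ, (k : ℝ) * (S n - K) ≤ keiperLiCoeff (n + k) - keiperLiCoeff n := by
    intro n hn k
    induction k with
    | zero => simp
    | succ k ih =>
      have hP := P' (n + k) (by omega)
      have hSm := hSmono n (n + k) (by omega)
      rw [hΔ, show n + k + 1 = n + (k + 1) by ring] at hP
      push_cast
      linarith
  -- Step 5: `S n − K ≤ log(2n) + 1` for all `n ≥ M₁`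
  have U : ∀ n : ℕ, M₁ ≤ n → S n - K ≤ Real.log (2 * n) + 1 := by
    intro n hn
    have hQ := Q n hn n
    have hlow := (hN₁ n (by omega)).1
    have hup := (hN₁ (n + n) (by omega)).2
    push_cast at hup
    rw [show ((n : ℝ) + n) = 2 * n by ring] at hup
    have hn1 : (1 : ℝ) ≤ n := by exact_mod_cast (show 1 ≤ n by omega)
    have hnpos : (0 : ℝ) < n := by linarith
    refine le_of_mul_le_mul_left ?_ hnpos
    nlinarith
  -- contradiction with `log x = o(√x)`
  have hs : 0 < Real.sqrt (η / 4) := Real.sqrt_pos.2 (by positivity)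
  set s := Real.sqrt (η / 4) with hsdef
  have hSs : ∀ n : ℕ, S n = s * Real.sqrt (2 * n) := fun n ↦ by
    rw [hS, hsdef, ← Real.sqrt_mul (by positivity)]
    congr 1
    ring
  have hlo := (isLittleO_log_rpow_atTop (show (0 : ℝ) < 1 / 2 by norm_num)).comp_tendsto
    (tendsto_natCast_atTop_atTop.const_mul_atTop (show (0 : ℝ) < 2 by norm_num))
  obtain ⟨N₂, hN₂⟩ := eventually_atTop.1 (hlo.def (show 0 < s / 2 by positivity))
  set A : ℝ := 2 * (1 + K) / s with hA
  have hA0 : 0 ≤ A := by positivity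
  set n : ℕ := max M₁ (max N₂ (⌈A ^ 2⌉₊ + 1)) with hn
  have hnM : M₁ ≤ n := le_max_left _ _
  have hnN₂ : N₂ ≤ n := (le_max_left _ _).trans (le_max_right _ _)
  have hnA : A ^ 2 < 2 * (n : ℝ) := by
    have h1 : ((⌈A ^ 2⌉₊ + 1 : ℕ) : ℝ) ≤ n := by
      exact_mod_cast (le_max_right _ _).trans (le_max_right M₁ _)
    push_cast at h1
    have h2 := Nat.le_ceil (A ^ 2)
    have h3 : (0 : ℝ) ≤ n := Nat.cast_nonneg n
    linarith
  have hlog : Real.log (2 * n) ≤ s / 2 * Real.sqrt (2 * n) := by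
    have h := hN₂ n hnN₂
    simp only [Function.comp_apply] at h
    rw [← Real.sqrt_eq_rpow, Real.norm_eq_abs, Real.norm_eq_abs, abs_of_nonneg (Real.sqrt_nonneg _)] at h
    exact (le_abs_self _).trans h
  have hsqrt : A < Real.sqrt (2 * n) := (Real.lt_sqrt hA0).2 hnA
  have hKs : 1 + K < s / 2 * Real.sqrt (2 * n) := by
    have : s / 2 * A = 1 + K := by
      rw [hA]
      field_simp
    nlinarith
  have hU := U n hnM
  rw [hSs] at hU
  linarith

/-- **THE TURÁN LAW, RH branch**: under RH the Turán determinant `λ_{n+1}² − λ_nλ_{n+2}` takes each sign infinitely often. -/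
theorem turan_two_signs_of_rh (hRH : _root_.RiemannHypothesis) :
    (∀ N : ℕ, ∃ n : ℕ, N ≤ n ∧ keiperLiCoeff (n + 1) ^ 2 < keiperLiCoeff n * keiperLiCoeff (n + 2)) ∧
    (∀ N : ℕ, ∃ n : ℕ, N ≤ n ∧ keiperLiCoeff n * keiperLiCoeff (n + 2) < keiperLiCoeff (n + 1) ^ 2) :=
  ⟨turanFail_io_of_rh hRH, turanHold_io_of_rh hRH⟩

/-- **Eventual log-concavity of the Li sequence refutes RH** (contrapositive of `turanFail_io_of_rh`). -/
theorem not_rh_of_eventually_logConcave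
    (h : ∃ N : ℕ, ∀ n : ℕ, N ≤ n → keiperLiCoeff n * keiperLiCoeff (n + 2) ≤ keiperLiCoeff (n + 1) ^ 2) :
    ¬ _root_.RiemannHypothesis := by
  rintro hRH
  obtain ⟨N, hN⟩ := h
  obtain ⟨n, hn, hlt⟩ := turanFail_io_of_rh hRH N
  exact absurd (hN n hn) (not_le.2 hlt)

/-- **Eventual log-convexity of the Li sequence refutes RH** (contrapositive of `turanHold_io_of_rh`). -/
theorem not_rh_of_eventually_logConvex
    (h : ∃ N : ℕ, ∀ n : ℕ, N ≤ n → keiperLiCoeff (n + 1) ^ 2 ≤ keiperLiCoeff n * keiperLiCoeff (n + 2)) :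
    ¬ _root_.RiemannHypothesis := by
  rintro hRH
  obtain ⟨N, hN⟩ := h
  obtain ⟨n, hn, hlt⟩ := turanHold_io_of_rh hRH N
  exact absurd (hN n hn) (not_le.2 hlt)

end Summit.RiemannHypothesis.RiemannHypothesis.Theorems.Splittings.LiTuranLaw

end
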